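import Mathlib.Algebra.Group.Subgroup.Finite
import Mathlib.Data.Set.Card
import HarnessLib

/-!
# Route ByReductionTypeAtTwo, crux `RankOneAtTwoBigImageOddLocal` (stmt-BirchSwinnertonDyer-23715):
# Kolyvagin's FIRST `2`-DESCENT OVER `ℚ` at a minimal door — Gross 1991 §10 at `p = 2`, eigenspace-free

Lead prover seat `bsd-line-fkl-p1` g11 (2026-08-28), `--supports stmt-BirchSwinnertonDyer-23715` (helper).  Pure algebra over
explicit hypotheses (theorems only, no definitions), in the format of the tree's
`Literature.NumberTheory.EllipticCurves.KolyvaginDescent.Hypotheses.card_sel` (`HeegnerPointsKolyvaginSelmerProofs.lean`: Gross 1991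
§10 for an ODD prime `p`, where complex conjugation `τ` splits `H¹(K, E[p])` and `Sel(E/K)_p` into `±`-eigenspaces and every
Čebotarev / duality step is made eigenspace by eigenspace).  At `p = 2` there are no eigenspaces.  The replacement proved here is
to DESCEND TO `ℚ`: at `M = 2` the curve `E` and its twin `E^K` have the same `2`-torsion module, so `Sel₂(E/ℚ)` and `Sel₂(E^K/ℚ)`
are two Selmer groups inside ONE `V = H¹(ℚ, E[2])`, cut out by local conditions `Loc v`, `Loc' v` which COINCIDE at every place
except the single «error place» `q₀` of a MINIMAL door (Mazur–Rubin 2010 Lemma 2.10; Kramer 1981: the local norm index of `K/ℚ`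
is non-trivial exactly at `q₀`) and are ONE LINE each at `q₀` (Mazur–Rubin 2010 Lemma 2.2 (i): `dim E(ℚ_{q₀})[2] = 1` at a
transposition prime).  Kolyvagin's first-layer classes `c(ℓ) ∈ H¹(ℚ, E[2])` (descended from `K` at `M = 2`, where the signs
`ε·(−1)^{f_n}` of Gross's Prop. 5.4 are invisible), Poitou–Tate over `ℚ` with the PERFECT pairing of the two lines
`H¹_ur(ℚ_ℓ, E[2])`, `H¹(ℚ_ℓ, E[2])/H¹_ur` at a Kolyvagin prime (`Δ_E < 0`: Frobenius is a transposition on `E[2]`), and Čebotarev at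
`M = 2` (`H¹(S₃, E[2]) = 0`: no inflation defect) then give, in order:

* `res_errorPlace_ne_zero_of_relaxed` — the localisation at `q₀` is INJECTIVE on the classes satisfying the common local conditions
  off `q₀` (Gross's Claim 10.1 / Prop. 10.2 run over `ℚ`; Mazur–Rubin's strict Selmer group `S_{q₀}` vanishes);
* `eq_zero_or_eq_heegner_of_mem_sel` — `Sel₂(E/ℚ) = {0, δy}` (Gross Prop. 2.3 at `2`, E-side; NO parity input), `card_sel_eq_two`;
* `eq_zero_of_mem_twinSel` — `Sel₂(E^K/ℚ) = 0` (input: `dim Sel₂(E^K/ℚ)` even — Cassels–Tate on the finite `Ш(E^K/ℚ)` of the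
  analytic-rank-`0` twin; Mazur–Rubin's transversality Lemma 2.11 is then not even needed), `twinSel_eq_bot`.

With `y = δ(T·y_K)` (`T = #E(K)_tors`, odd; `T·y_K ∈ E(ℚ)` in analytic rank one) and `E(ℚ)/2E(ℚ) ≅ 𝔽₂` (rank one, `E(ℚ)[2] = 0`)
this is `Ш(E/ℚ)[2] = 0 ∧ Ш(E^K/ℚ)[2] = 0` from `y_K ∉ 2E(K)` — the bottom rung U₀⁻ (`m = 0`, `Δ_W < 0`, minimal door `t = 1`,
`s = 0`) of the Euler-system half `DoorIndexLawUpperCAtTwo` of the one-door law (lead reports G10 §3 and G11).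

DICTIONARY hypothesis ↦ arithmetic input (instantiation on the slice: `ρ_{E,2^∞}` onto, odd Tamagawa product, analytic rank one,
`Δ_E < 0`, `K` a Kolyvagin-admissible door field with exactly one prime `q₀ ∣ d_K` at which `#Ẽ(𝔽_{q₀})` is even):
`V = H¹(ℚ, E[2])`; `Loc v` / `Loc' v` = Kummer conditions of `E` / `E^K`; `hloc'` = MR10 Lemma 2.10 at `v ≠ q₀` ((i) split `v ∣ 2N`,
(ii) ramified 3-cycle primes, (iv) `∞` with `Δ_E < 0`, (v) good unramified); `A₀ = ker res_{q₀}`; `hline`, `hline'` = MR10 Lemma 2.2 (i)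
at `q₀` for `E`, `E^K`; `Kol ℓ` = Kolyvagin prime for `(E, K, 2)` (`ℓ ∤ 2Nd_K`, `Frob_ℓ = [c]` in `Gal(K(E[2])/ℚ)`); `A ℓ = ker res_ℓ`;
`y = δ(T·y_K)`; `c ℓ` = Kolyvagin's class `c(ℓ)` descended to `ℚ` (inf–res is an isomorphism: `E(K)[2] = 0`); `hc` = Gross Prop. 6.2 (1)
at `2` descended from `K_w` to `ℚ_v` at `v ∉ {ℓ, q₀}` (descent obstruction = Kramer's local norm index, trivial off `q₀`); `hcℓ` = Gross
Prop. 6.2 (2) / McCallum Prop. 4.4 at `2` with `n = ℓ` (`d(ℓ)_ℓ = 0 ⟺ y_K ∈ 2E(K_λ) ⟺ res_ℓ y = 0`, as `H¹(K_λ/ℚ_ℓ, E[2]) = 0` for a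
transposition); `hrec` = Poitou–Tate for two global classes + isotropy of the Kummer conditions + perfect pairing of the two lines at
`ℓ`; `hceb₂` / `hceb₁` = McCallum Cor. 3.2 at `M = 2` over `ℚ` (`r = 2`, `r = 1`); `heven` = Cassels–Tate parity for `Sel₂(E^K/ℚ) =
Ш(E^K/ℚ)[2]` (`E^K(ℚ)` finite of odd order by `L(E^K,1) ≠ 0` and Gross–Zagier–Kolyvagin).  Which of these are tree theorems, printed
theorems, or the `M = 2` face of route GenusKolyvaginAtTwo's item 24880 is recorded in
`Cruxes/RankOneAtTwoBigImageOddLocal/OneDoorLeadReportG11.md`.  Nothing about elliptic curves is asserted here; BSD is not proved by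
any of this.

References: [GrossLMS1991] §§2, 6, 8–10; [McCallumLMS1991] Cor. 3.2, Prop. 4.4; [MazurRubin2010] Lemmas 2.2, 2.9–2.11, Def. 3.1,
Prop. 3.3; [Kramer1981] Thm. 1, Prop. 3; [Kolyvagin1990] Thm. A.
-/

set_option autoImplicit false
-- the Theorems namespace of this sub repeats the summit name by design (D-0017 nested layout)
set_option linter.dupNamespace false

namespace Summit.BirchSwinnertonDyer.BirchSwinnertonDyer.Theorems.RankOneAtTwoOneDoor

section FirstDescentAtTwo

variable {V : Type*} [AddCommGroup V] {Pl : Type*}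

/-- **The key step of the first `2`-descent over `ℚ` (Gross 1991 §10 at `p = 2`): the localisation at the error place `q₀` is
injective on RELAXED classes** (classes in `E`'s local condition `Loc v` at every `v ≠ q₀`).  Data: `Loc` (Kummer conditions of `E`
in `V = H¹(ℚ, E[2])`), `q₀` (error place), `A₀ = ker res_{q₀}`, `Kol` (Kolyvagin primes), `pl ℓ` (the place `ℓ`), `A ℓ = ker res_ℓ`,
`y = δ(T·y_K)`, `c ℓ` (Kolyvagin's descended first-layer class).  Hypotheses: `hc` = Gross Prop. 6.2 (1) at `2` off `{ℓ, q₀}`;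
`hcℓ` = Prop. 6.2 (2) at `2`; `hrec` = Poitou–Tate + perfect pairing of the lines at `ℓ` (`Δ_E < 0`); `hceb₂`, `hceb₁` = Čebotarev at
`M = 2` over `ℚ`.  Proof: for `s = y` take `ℓ` with `res_ℓ y ≠ 0` (`hceb₁`), so `c(ℓ)` is singular at `ℓ` (`hcℓ`), and reciprocity
for `(y, c(ℓ))`; for `s ∉ {0, y}` take `ℓ` with `res_ℓ s ≠ 0`, `res_ℓ y ≠ 0` (`hceb₂`) and reciprocity for `(s, c(ℓ))`.
[cite: GrossLMS1991, §10 (Claim 10.1, Prop. 10.2)] [cite: McCallumLMS1991, Cor. 3.2] -/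
theorem res_errorPlace_ne_zero_of_relaxed (Loc : Pl → AddSubgroup V) (q₀ : Pl) (A₀ : AddSubgroup V) (Kol : ℕ → Prop)
    (pl : ℕ → Pl) (A : ℕ → AddSubgroup V) (y : V) (c : ℕ → V)
    (hc : ∀ ℓ, Kol ℓ → ∀ v, v ≠ pl ℓ → v ≠ q₀ → c ℓ ∈ Loc v)
    (hcℓ : ∀ ℓ, Kol ℓ → (c ℓ ∈ Loc (pl ℓ) ↔ y ∈ A ℓ))
    (hrec : ∀ ℓ, Kol ℓ → ∀ d : V, (∀ v, v ≠ pl ℓ → v ≠ q₀ → d ∈ Loc v) → d ∉ Loc (pl ℓ) →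
      ∀ s : V, (∀ v, v ≠ q₀ → s ∈ Loc v) → s ∉ A ℓ → s ∉ A₀)
    (hceb₂ : ∀ s : V, s ≠ 0 → s ≠ y → (∀ v, v ≠ q₀ → s ∈ Loc v) → ∃ ℓ, Kol ℓ ∧ s ∉ A ℓ ∧ y ∉ A ℓ)
    (hceb₁ : ∃ ℓ, Kol ℓ ∧ y ∉ A ℓ)
    {s : V} (hs : ∀ v, v ≠ q₀ → s ∈ Loc v) (h0 : s ≠ 0) : s ∉ A₀ := by
  have hsing : ∀ ℓ, Kol ℓ → y ∉ A ℓ → c ℓ ∉ Loc (pl ℓ) := fun ℓ hℓ hy h => hy ((hcℓ ℓ hℓ).mp h)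
  by_cases hy : s = y
  · obtain ⟨ℓ, hℓ, hyA⟩ := hceb₁
    have hsA : s ∉ A ℓ := by rw [hy]; exact hyA
    exact hrec ℓ hℓ (c ℓ) (hc ℓ hℓ) (hsing ℓ hℓ hyA) s hs hsA
  · obtain ⟨ℓ, hℓ, hsA, hyA⟩ := hceb₂ s h0 hy hs
    exact hrec ℓ hℓ (c ℓ) (hc ℓ hℓ) (hsing ℓ hℓ hyA) s hs hsA

/-- **Mazur–Rubin's STRICT Selmer group at `T = {q₀}` vanishes**: two relaxed classes with the same localisation at `q₀` are equal
(apply injectivity to their difference, which is relaxed because each `Loc v` is a subgroup).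
[cite: MazurRubin2010, Def. 3.1 and Prop. 3.3] [cite: GrossLMS1991, §10] -/
theorem eq_of_relaxed_of_sub_mem_errorKer (Loc : Pl → AddSubgroup V) (q₀ : Pl) (A₀ : AddSubgroup V) (Kol : ℕ → Prop)
    (pl : ℕ → Pl) (A : ℕ → AddSubgroup V) (y : V) (c : ℕ → V)
    (hc : ∀ ℓ, Kol ℓ → ∀ v, v ≠ pl ℓ → v ≠ q₀ → c ℓ ∈ Loc v)
    (hcℓ : ∀ ℓ, Kol ℓ → (c ℓ ∈ Loc (pl ℓ) ↔ y ∈ A ℓ))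
    (hrec : ∀ ℓ, Kol ℓ → ∀ d : V, (∀ v, v ≠ pl ℓ → v ≠ q₀ → d ∈ Loc v) → d ∉ Loc (pl ℓ) →
      ∀ s : V, (∀ v, v ≠ q₀ → s ∈ Loc v) → s ∉ A ℓ → s ∉ A₀)
    (hceb₂ : ∀ s : V, s ≠ 0 → s ≠ y → (∀ v, v ≠ q₀ → s ∈ Loc v) → ∃ ℓ, Kol ℓ ∧ s ∉ A ℓ ∧ y ∉ A ℓ)
    (hceb₁ : ∃ ℓ, Kol ℓ ∧ y ∉ A ℓ)
    {s t : V} (hs : ∀ v, v ≠ q₀ → s ∈ Loc v) (ht : ∀ v, v ≠ q₀ → t ∈ Loc v) (hst : s - t ∈ A₀) : s = t := by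
  by_contra hne
  exact res_errorPlace_ne_zero_of_relaxed Loc q₀ A₀ Kol pl A y c hc hcℓ hrec hceb₂ hceb₁
    (fun v hv => (Loc v).sub_mem (hs v hv) (ht v hv)) (sub_ne_zero.mpr hne) hst

/-- **Gross 1991, Prop. 2.3 at `p = 2`, E-side: `Sel₂(E/ℚ) = {0, δy}`.**  Extra data: `Sel = Sel₂(E/ℚ)` cut out by `Loc`
(`hsel`), `y ∈ Sel` (`hy`).  Extra hypothesis `hline` = MR10 Lemma 2.2 (i) at `q₀` (`H¹_f(ℚ_{q₀}, E[2]) ≅ E(ℚ_{q₀})/2` is ONE line: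
two classes of `Loc q₀` with non-zero localisation differ by an element of `ker res_{q₀}`).  A non-zero Selmer class `s` and `y`
both localise non-trivially into that line, so `s − y ∈ ker res_{q₀}` is a relaxed class, hence `s = y`.  No Cassels–Tate input on
this side. [cite: GrossLMS1991, Prop. 2.3 and §10] [cite: MazurRubin2010, Lemma 2.2 (i)] -/
theorem eq_zero_or_eq_heegner_of_mem_sel (Loc : Pl → AddSubgroup V) (q₀ : Pl) (A₀ : AddSubgroup V) (Kol : ℕ → Prop)
    (pl : ℕ → Pl) (A : ℕ → AddSubgroup V) (y : V) (c : ℕ → V)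
    (hc : ∀ ℓ, Kol ℓ → ∀ v, v ≠ pl ℓ → v ≠ q₀ → c ℓ ∈ Loc v)
    (hcℓ : ∀ ℓ, Kol ℓ → (c ℓ ∈ Loc (pl ℓ) ↔ y ∈ A ℓ))
    (hrec : ∀ ℓ, Kol ℓ → ∀ d : V, (∀ v, v ≠ pl ℓ → v ≠ q₀ → d ∈ Loc v) → d ∉ Loc (pl ℓ) →
      ∀ s : V, (∀ v, v ≠ q₀ → s ∈ Loc v) → s ∉ A ℓ → s ∉ A₀)
    (hceb₂ : ∀ s : V, s ≠ 0 → s ≠ y → (∀ v, v ≠ q₀ → s ∈ Loc v) → ∃ ℓ, Kol ℓ ∧ s ∉ A ℓ ∧ y ∉ A ℓ)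
    (hceb₁ : ∃ ℓ, Kol ℓ ∧ y ∉ A ℓ)
    (hline : ∀ s t : V, s ∈ Loc q₀ → t ∈ Loc q₀ → s ∉ A₀ → t ∉ A₀ → s - t ∈ A₀)
    (Sel : AddSubgroup V) (hsel : ∀ s, s ∈ Sel ↔ ∀ v, s ∈ Loc v) (hy : y ∈ Sel)
    {s : V} (hs : s ∈ Sel) : s = 0 ∨ s = y := by
  by_cases h0 : s = 0
  · exact Or.inl h0
  right
  have hrel : ∀ {u : V}, u ∈ Sel → ∀ v, v ≠ q₀ → u ∈ Loc v := fun hu v _ => (hsel _).mp hu v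
  have hy0 : y ≠ 0 := by
    -- `y = 0` contradicts `hceb₁`: `0 ∈ A ℓ` for every subgroup
    intro h
    obtain ⟨ℓ, -, hℓ⟩ := hceb₁
    exact hℓ (by rw [h]; exact (A ℓ).zero_mem)
  have hsA : s ∉ A₀ := res_errorPlace_ne_zero_of_relaxed Loc q₀ A₀ Kol pl A y c hc hcℓ hrec hceb₂ hceb₁ (hrel hs) h0
  have hyA : y ∉ A₀ := res_errorPlace_ne_zero_of_relaxed Loc q₀ A₀ Kol pl A y c hc hcℓ hrec hceb₂ hceb₁ (hrel hy) hy0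
  exact eq_of_relaxed_of_sub_mem_errorKer Loc q₀ A₀ Kol pl A y c hc hcℓ hrec hceb₂ hceb₁ (hrel hs) (hrel hy)
    (hline s y ((hsel s).mp hs q₀) ((hsel y).mp hy q₀) hsA hyA)

/-- **`#Sel₂(E/ℚ) = 2`** under the hypotheses of `eq_zero_or_eq_heegner_of_mem_sel` and `y ≠ 0` (`y_K ∉ 2E(K)`); with
`E(ℚ)/2E(ℚ) ≅ 𝔽₂ ↪ Sel₂(E/ℚ)` (rank one, no rational `2`-torsion) this is `Ш(E/ℚ)[2] = 0` at instantiation ((2.2) of Gross).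
[cite: GrossLMS1991, Prop. 2.3 and (2.2)] -/
theorem card_sel_eq_two (Loc : Pl → AddSubgroup V) (q₀ : Pl) (A₀ : AddSubgroup V) (Kol : ℕ → Prop)
    (pl : ℕ → Pl) (A : ℕ → AddSubgroup V) (y : V) (c : ℕ → V)
    (hc : ∀ ℓ, Kol ℓ → ∀ v, v ≠ pl ℓ → v ≠ q₀ → c ℓ ∈ Loc v)
    (hcℓ : ∀ ℓ, Kol ℓ → (c ℓ ∈ Loc (pl ℓ) ↔ y ∈ A ℓ))
    (hrec : ∀ ℓ, Kol ℓ → ∀ d : V, (∀ v, v ≠ pl ℓ → v ≠ q₀ → d ∈ Loc v) → d ∉ Loc (pl ℓ) →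
      ∀ s : V, (∀ v, v ≠ q₀ → s ∈ Loc v) → s ∉ A ℓ → s ∉ A₀)
    (hceb₂ : ∀ s : V, s ≠ 0 → s ≠ y → (∀ v, v ≠ q₀ → s ∈ Loc v) → ∃ ℓ, Kol ℓ ∧ s ∉ A ℓ ∧ y ∉ A ℓ)
    (hceb₁ : ∃ ℓ, Kol ℓ ∧ y ∉ A ℓ)
    (hline : ∀ s t : V, s ∈ Loc q₀ → t ∈ Loc q₀ → s ∉ A₀ → t ∉ A₀ → s - t ∈ A₀)
    (Sel : AddSubgroup V) (hsel : ∀ s, s ∈ Sel ↔ ∀ v, s ∈ Loc v) (hy : y ∈ Sel) (hy0 : y ≠ 0) :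
    Nat.card Sel = 2 := by
  have hset : (Sel : Set V) = {0, y} := by
    ext s
    simp only [SetLike.mem_coe, Set.mem_insert_iff, Set.mem_singleton_iff]
    refine ⟨fun hs => eq_zero_or_eq_heegner_of_mem_sel Loc q₀ A₀ Kol pl A y c hc hcℓ hrec hceb₂ hceb₁ hline Sel hsel hy hs,
      ?_⟩
    rintro (rfl | rfl)
    · exact Sel.zero_mem
    · exact hy
  rw [← SetLike.coe_sort_coe, hset, Nat.card_coe_set_eq, Set.ncard_pair (fun h => hy0 h.symm)]

/-- **Twin side: `Sel₂(E^K/ℚ) = 0`.**  Extra data: `Loc'` (Kummer conditions of `E^K` in the same `H¹(ℚ, E[2])`) with `hloc'` =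
MR10 Lemma 2.10 (`Loc' v = Loc v` for `v ≠ q₀`), `Sel' = Sel₂(E^K/ℚ)` cut out by `Loc'` (`hsel'`), `hline'` = MR10 Lemma 2.2 (i) at `q₀`
for `E^K`, and `heven` = Cassels–Tate parity (`Sel₂(E^K/ℚ) = Ш(E^K/ℚ)[2]` has even dimension: a non-zero class is never alone).  A
non-zero `s ∈ Sel'` comes with `t ∈ Sel'`, `t ∉ {0, s}`; both are relaxed with non-zero localisation in the ONE line
`H¹_f(ℚ_{q₀}, E^K[2])`, so `t − s ∈ ker res_{q₀}` is relaxed and non-zero — contradicting injectivity.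
[cite: GrossLMS1991, §10] [cite: MazurRubin2010, Lemmas 2.2 (i), 2.10] -/
theorem eq_zero_of_mem_twinSel (Loc : Pl → AddSubgroup V) (q₀ : Pl) (A₀ : AddSubgroup V) (Kol : ℕ → Prop)
    (pl : ℕ → Pl) (A : ℕ → AddSubgroup V) (y : V) (c : ℕ → V)
    (hc : ∀ ℓ, Kol ℓ → ∀ v, v ≠ pl ℓ → v ≠ q₀ → c ℓ ∈ Loc v)
    (hcℓ : ∀ ℓ, Kol ℓ → (c ℓ ∈ Loc (pl ℓ) ↔ y ∈ A ℓ))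
    (hrec : ∀ ℓ, Kol ℓ → ∀ d : V, (∀ v, v ≠ pl ℓ → v ≠ q₀ → d ∈ Loc v) → d ∉ Loc (pl ℓ) →
      ∀ s : V, (∀ v, v ≠ q₀ → s ∈ Loc v) → s ∉ A ℓ → s ∉ A₀)
    (hceb₂ : ∀ s : V, s ≠ 0 → s ≠ y → (∀ v, v ≠ q₀ → s ∈ Loc v) → ∃ ℓ, Kol ℓ ∧ s ∉ A ℓ ∧ y ∉ A ℓ)
    (hceb₁ : ∃ ℓ, Kol ℓ ∧ y ∉ A ℓ)
    (Loc' : Pl → AddSubgroup V) (hloc' : ∀ v, v ≠ q₀ → Loc' v = Loc v)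
    (hline' : ∀ s t : V, s ∈ Loc' q₀ → t ∈ Loc' q₀ → s ∉ A₀ → t ∉ A₀ → s - t ∈ A₀)
    (Sel' : AddSubgroup V) (hsel' : ∀ s, s ∈ Sel' ↔ ∀ v, s ∈ Loc' v)
    (heven : ∀ s ∈ Sel', s ≠ 0 → ∃ t ∈ Sel', t ≠ 0 ∧ t ≠ s)
    {s : V} (hs : s ∈ Sel') : s = 0 := by
  have hrel : ∀ {u : V}, u ∈ Sel' → ∀ v, v ≠ q₀ → u ∈ Loc v := by
    intro u hu v hv
    rw [← hloc' v hv]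
    exact (hsel' u).mp hu v
  by_contra h0
  obtain ⟨t, ht, ht0, hts⟩ := heven s hs h0
  have hsA : s ∉ A₀ := res_errorPlace_ne_zero_of_relaxed Loc q₀ A₀ Kol pl A y c hc hcℓ hrec hceb₂ hceb₁ (hrel hs) h0
  have htA : t ∉ A₀ := res_errorPlace_ne_zero_of_relaxed Loc q₀ A₀ Kol pl A y c hc hcℓ hrec hceb₂ hceb₁ (hrel ht) ht0
  exact hts (eq_of_relaxed_of_sub_mem_errorKer Loc q₀ A₀ Kol pl A y c hc hcℓ hrec hceb₂ hceb₁ (hrel ht) (hrel hs)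
    (hline' t s ((hsel' t).mp ht q₀) ((hsel' s).mp hs q₀) htA hsA))

/-- **`Sel₂(E^K/ℚ) = ⊥`** (so `Ш(E^K/ℚ)[2] = 0` at instantiation), under the hypotheses of `eq_zero_of_mem_twinSel`.
[cite: GrossLMS1991, §10] [cite: MazurRubin2010, Lemma 2.10] -/
theorem twinSel_eq_bot (Loc : Pl → AddSubgroup V) (q₀ : Pl) (A₀ : AddSubgroup V) (Kol : ℕ → Prop)
    (pl : ℕ → Pl) (A : ℕ → AddSubgroup V) (y : V) (c : ℕ → V)
    (hc : ∀ ℓ, Kol ℓ → ∀ v, v ≠ pl ℓ → v ≠ q₀ → c ℓ ∈ Loc v)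
    (hcℓ : ∀ ℓ, Kol ℓ → (c ℓ ∈ Loc (pl ℓ) ↔ y ∈ A ℓ))
    (hrec : ∀ ℓ, Kol ℓ → ∀ d : V, (∀ v, v ≠ pl ℓ → v ≠ q₀ → d ∈ Loc v) → d ∉ Loc (pl ℓ) →
      ∀ s : V, (∀ v, v ≠ q₀ → s ∈ Loc v) → s ∉ A ℓ → s ∉ A₀)
    (hceb₂ : ∀ s : V, s ≠ 0 → s ≠ y → (∀ v, v ≠ q₀ → s ∈ Loc v) → ∃ ℓ, Kol ℓ ∧ s ∉ A ℓ ∧ y ∉ A ℓ)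
    (hceb₁ : ∃ ℓ, Kol ℓ ∧ y ∉ A ℓ)
    (Loc' : Pl → AddSubgroup V) (hloc' : ∀ v, v ≠ q₀ → Loc' v = Loc v)
    (hline' : ∀ s t : V, s ∈ Loc' q₀ → t ∈ Loc' q₀ → s ∉ A₀ → t ∉ A₀ → s - t ∈ A₀)
    (Sel' : AddSubgroup V) (hsel' : ∀ s, s ∈ Sel' ↔ ∀ v, s ∈ Loc' v)
    (heven : ∀ s ∈ Sel', s ≠ 0 → ∃ t ∈ Sel', t ≠ 0 ∧ t ≠ s) :
    Sel' = ⊥ :=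
  (AddSubgroup.eq_bot_iff_forall _).mpr fun _ hs =>
    eq_zero_of_mem_twinSel Loc q₀ A₀ Kol pl A y c hc hcℓ hrec hceb₂ hceb₁ Loc' hloc' hline' Sel' hsel' heven hs

end FirstDescentAtTwo

end Summit.BirchSwinnertonDyer.BirchSwinnertonDyer.Theorems.RankOneAtTwoOneDoor
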